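import Literature.NumberTheory.GaloisCohomology.BrauerHassePrinciple
import Literature.NumberTheory.GaloisRepresentations.TateLevelOneHasseDescent
import Literature.NumberTheory.GaloisRepresentations.TateH2VanishingArchimedean
import Literature.NumberTheory.GaloisRepresentations.GaloisCohomologyKummerProofs
import Literature.NumberTheory.GaloisRepresentations.AbsGaloisGroupProofs
import Mathlib.NumberTheory.RamificationInertia.Valuation
import Mathlib.NumberTheory.NumberField.Completion.LiesOverInstances
import HarnessLib

/-!
# Tate's theorem `H²(G_ℚ, ℚ/ℤ) = 0` at level one, VII: the Hasse input at an odd prime `p` from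
# the Hasse principle for the Brauer group of `ℚ(μ_p)` (Serre, Durham 1977, §6.5 (a), (c))

Sibling proof file (theorems only) of `TateProjectiveLifting.lean`; continuation of
`TateLevelOneHasseDescent.lean`.  There, Tate's theorem for `ℚ` at an odd prime `p` was reduced to
the *Hasse input at `p`*: a locally constant `p`-torsion `2`-cocycle `z` on `Γ_ℚ` which is, at
every finite place `v` of `ℚ`, the coboundary on `Γ_{ℚ_v}` of a locally constant `p`-torsion
cochain, splits on `Γ_K`, `K = ℚ(μ_p)`.  Serre (§6.5 (a), (c)) obtains this from
`H²(G_K, ℤ/p) = H²(G_K, μ_p) = Br_p(K)` and "an element `α ∈ Br_p(K)` is described by its local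
components" — the Hasse principle of Brauer–Hasse–Noether.  This file carries out that deduction
from the named fact `Literature.NumberTheory.GaloisCohomology.brauerHassePrinciple K` (cochain form
of `Br K ↪ ⊕_v Br K_v`, Harari Thm. 14.11):

* `twoCocycle_conj_eq_add_coboundary` — conjugation changes a `2`-cocycle (trivial coefficients)
  by an explicit coboundary (Serre, *Corps locaux* VII §5 Prop. 3);
* `exists_mulExp_of_isPrimitiveRoot` — the dictionary `(1/p)ℤ/ℤ ≅ μ_p`, `x ↦ ζ^{px}`;
* `rat_localSplitting_transfer_finite` — **local conditions at the places of `K` from those at the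
  places of `ℚ`** (finite places): the two restriction maps `Γ_{K_w} → Γ_ℚ` through `K` and through
  `ℚ_v` (`w ∣ v`) are compatible with two `ℚ`-embeddings `ℚ̄ → \bar{K_w}`, which differ by an element
  of `Γ_ℚ` (`exists_absClosureEmbedding_comp_eq`), hence are conjugate, so that a `p`-torsion
  splitting of `z` on `Γ_{ℚ_v}` transports to one on `Γ_{K_w}`;
* `localSplitting_infinite_of_odd` — at an infinite place `w` of `K`, `Γ_{K_w}` has order `≤ 2`,
  so for odd `p` every `p`-torsion cocycle on it is the coboundary of a `p`-torsion cochain;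
* `hasseInput_of_brauerHassePrinciple` — **the Hasse input at `p` from
  `brauerHassePrinciple K`** (`μ_p ⊂ K`, `p` odd or `K` totally complex; used with `K = ℚ(μ_p)`,
  and with `K = ℚ(i)` for `p = 2` in the sequel): `e = ζ^{pz}` restricted to `Γ_K` is a locally
  constant `K̄ˣ`-valued `2`-cocycle (Galois action trivial on `μ_p ⊂ K`), locally a coboundary at all
  places of `K` by the two transfers; by the fact it is a coboundary `∂b`; `b^p` is a `1`-cocycle,
  hence `= σ(a)/a` (Hilbert 90, `exists_eq_smul_div_of_isLocallyConstant_cocycle`), and correcting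
  `b` by a `p`-th root of `a` makes it `μ_p`-valued, whence `z|_{Γ_K} = ∂β` with `β` locally
  constant;
* `twoCocycle_addCircle_prime_split_rat_of_brauerHassePrinciple` and
  `Tate_projectiveLifting_of_brauerHassePrinciple` — `(H_p)(Γ_ℚ)` for odd `p`, and
  `Tate_projectiveLifting`, from `brauerHassePrinciple (ℚ(μ_p))` (all odd `p`) and `(H_2)(Γ_ℚ)`.

## References

* J.-P. Serre, *Modular forms of weight one and Galois representations* (Durham 1977), §6.5 (a),
  (c). [SerreDurham1977]
* D. Harari, *Galois Cohomology and Class Field Theory* (2020), Thm. 14.11, §13.1. [Harari2020]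
* J.-P. Serre, *Local Fields* (1979), Ch. VII §5 Prop. 3; Ch. X §1 Prop. 2 (Hilbert 90).
  [SerreLocalFields1979]
-/

noncomputable section

open Field ValuativeRel IsDedekindDomain NumberField
open scoped Pointwise NumberField

namespace Literature.NumberTheory.GaloisRepresentations

open Literature.NumberTheory.GaloisCohomology

/-! ### Conjugation and `2`-cocycles with trivial coefficients -/

section Conj

variable {G : Type*} [Group G] {A : Type*} [AddCommGroup A]

/-- **Inner automorphisms change a `2`-cocycle by an explicit coboundary** (trivial coefficients,
additive notation): for a `2`-cocycle `z` and `τ ∈ G`,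
`z(τ⁻¹aτ, τ⁻¹bτ) + c(ab) = z(a,b) + c(a) + c(b)` with `c(a) = z(τ, τ⁻¹aτ) - z(a,τ)`.
Ref: Serre, *Corps locaux* VII §5 Prop. 3 (degree `2`). [cite: SerreLocalFields1979, Ch. VII §5 Prop. 3] -/
theorem twoCocycle_conj_eq_add_coboundary (z : G → G → A)
    (hcoc : ∀ σ τ υ, z σ τ + z (σ * τ) υ = z τ υ + z σ (τ * υ)) (τ a b : G) :
    z (τ⁻¹ * a * τ) (τ⁻¹ * b * τ) + (z τ (τ⁻¹ * (a * b) * τ) - z (a * b) τ) =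
      z a b + (z τ (τ⁻¹ * a * τ) - z a τ) + (z τ (τ⁻¹ * b * τ) - z b τ) := by
  have h1 := hcoc τ (τ⁻¹ * a * τ) (τ⁻¹ * b * τ)
  have h2 := hcoc a τ (τ⁻¹ * b * τ)
  have h3 := hcoc a b τ
  have e1 : τ * (τ⁻¹ * a * τ) = a * τ := by group
  have e2 : τ⁻¹ * a * τ * (τ⁻¹ * b * τ) = τ⁻¹ * (a * b) * τ := by group
  have e3 : τ * (τ⁻¹ * b * τ) = b * τ := by group
  rw [e1, e2] at h1
  rw [e3] at h2
  -- solve the three cocycle identities for the terms to be eliminated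
  have g1 : z (τ⁻¹ * a * τ) (τ⁻¹ * b * τ) =
      z τ (τ⁻¹ * a * τ) + z (a * τ) (τ⁻¹ * b * τ) - z τ (τ⁻¹ * (a * b) * τ) :=
    eq_sub_of_add_eq h1.symm
  have g2 : z (a * τ) (τ⁻¹ * b * τ) = z τ (τ⁻¹ * b * τ) + z a (b * τ) - z a τ :=
    eq_sub_of_add_eq (by rw [add_comm]; exact h2)
  have g3 : z a (b * τ) = z a b + z (a * b) τ - z b τ :=
    eq_sub_of_add_eq (by rw [add_comm]; exact h3.symm)
  rw [g1, g2, g3]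
  abel

end Conj

/-! ### The dictionary `(1/p)ℤ/ℤ ≅ μ_p` -/

section MulExp

variable {Ω : Type*} [CommMonoid Ω]

/-- **`(1/p)ℤ/ℤ ≅ μ_p`** as functions: for a primitive `p`-th root of unity `ζ` (`p ≥ 1`) there is
`m : ℚ/ℤ → Ω` with `m(x + y) = m(x) m(y)` and `m x = m y → x = y` on `p`-torsion elements, `m 0 = 1`,
`(m x)^p = 1`, and every value a power of `ζ`; moreover every power of `ζ` is `m` of a `p`-torsion
element. [folklore] -/
theorem exists_mulExp_of_isPrimitiveRoot {p : ℕ} (hp : 0 < p) {ζ : Ω} (hζ : IsPrimitiveRoot ζ p) :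
    ∃ m : AddCircle (1 : ℚ) → Ω,
      (∀ x y, p • x = 0 → p • y = 0 → m (x + y) = m x * m y) ∧
      (∀ x y, p • x = 0 → p • y = 0 → m x = m y → x = y) ∧ m 0 = 1 ∧ (∀ x, m x ^ p = 1) ∧
      (∀ x, ∃ k : ℕ, m x = ζ ^ k) ∧
      ∀ k : ℕ, ∃ x, p • x = 0 ∧ m x = ζ ^ k := by
  classical
  haveI : NeZero p := ⟨hp.ne'⟩
  obtain ⟨e, he_inj, -, he_surj⟩ := zmod_exists_addMonoidHom_addCircle hp
  have hpre : ∀ x : AddCircle (1 : ℚ), ∃ k : ZMod p, p • x = 0 → e k = x := fun x => by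
    by_cases hx : p • x = 0
    · obtain ⟨k, hk⟩ := he_surj x hx
      exact ⟨k, fun _ => hk⟩
    · exact ⟨0, fun h => absurd h hx⟩
  choose ψ hψ using hpre
  have hpe : ∀ k : ZMod p, p • e k = 0 := fun k => by
    rw [← map_nsmul, nsmul_eq_mul, ZMod.natCast_self, zero_mul, map_zero]
  have hψe : ∀ k : ZMod p, ψ (e k) = k := fun k => he_inj (hψ _ (hpe k))
  have hψadd : ∀ x y, p • x = 0 → p • y = 0 → ψ (x + y) = ψ x + ψ y := fun x y hx hy => by
    apply he_inj
    rw [map_add, hψ x hx, hψ y hy, hψ (x + y) (by rw [nsmul_add, hx, hy, add_zero])]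
  have hmod : ∀ n : ℕ, ζ ^ (n % p) = ζ ^ n := fun n => by
    conv_rhs => rw [← Nat.mod_add_div n p, pow_add, pow_mul, hζ.pow_eq_one, one_pow, mul_one]
  refine ⟨fun x => ζ ^ (ψ x).val, fun x y hx hy => ?_, fun x y hx hy hxy => ?_, ?_, fun x => ?_,
    fun x => ⟨_, rfl⟩, fun k => ⟨e k, hpe k, ?_⟩⟩
  · show ζ ^ (ψ (x + y)).val = ζ ^ (ψ x).val * ζ ^ (ψ y).val
    rw [hψadd x y hx hy, ZMod.val_add, hmod, pow_add]
  · change ζ ^ (ψ x).val = ζ ^ (ψ y).val at hxy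
    have h1 : (ψ x).val = (ψ y).val := hζ.pow_inj (ZMod.val_lt _) (ZMod.val_lt _) hxy
    rw [← hψ x hx, ← hψ y hy, ZMod.val_injective p h1]
  · show ζ ^ (ψ 0).val = 1
    have h0 : ψ 0 = 0 := by rw [← map_zero e, hψe]
    rw [h0, ZMod.val_zero, pow_zero]
  · show (ζ ^ (ψ x).val) ^ p = 1
    rw [← pow_mul, mul_comm, pow_mul, hζ.pow_eq_one, one_pow]
  · show ζ ^ (ψ (e k)).val = ζ ^ k
    rw [hψe, ZMod.val_natCast, hmod]

end MulExp

/-! ### Local conditions at the finite places of `K` from those at the places of `ℚ` -/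

section FiniteTransfer

variable (K : Type) [Field K] [NumberField K]

/-- **Transfer of a local splitting from `Γ_{ℚ_v}` to `Γ_{K_w}`** (`K` a number field, `w` a finite
place of `K`, `v` a finite place of `ℚ` with a ring homomorphism `f : ℚ_v → K_w`, e.g. `w ∣ v`).
The two restriction maps `Γ_{K_w} → Γ_ℚ` — through `Γ_K` (`res_{K/ℚ} ∘ res_{K_w/K}`) and through
`Γ_{ℚ_v}` (`res_{ℚ_v/ℚ} ∘ res_{K_w/ℚ_v}`, along `f`) — are compatible with two `ℚ`-embeddings
`ℚ̄ → \bar{K_w}`, which differ by an element `τ ∈ Γ_ℚ` (`exists_absClosureEmbedding_comp_eq`), so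
the two maps are conjugate by `τ`; since conjugation changes a `2`-cocycle with trivial coefficients
by an explicit coboundary (`twoCocycle_conj_eq_add_coboundary`), a `p`-torsion locally constant
splitting of `z` on `Γ_{ℚ_v}` yields one of `z ∘ (res_{K/ℚ} × res_{K/ℚ})` on `Γ_{K_w}`.
(Serre, *Galois Cohomology* I §2.4, II §1.1: localisation is independent of the embedding.)
[cite: SerreGaloisCohomology1997, II §1.1] [cite: Harari2020, §13.1] -/
theorem rat_localSplitting_transfer_finite {p : ℕ}
    (z : absoluteGaloisGroup ℚ → absoluteGaloisGroup ℚ → AddCircle (1 : ℚ))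
    (hz_lc : IsLocallyConstant (Function.uncurry z))
    (hz_coc : ∀ σ τ υ, z σ τ + z (σ * τ) υ = z τ υ + z σ (τ * υ)) (hz_p : ∀ σ τ, p • z σ τ = 0)
    (w : HeightOneSpectrum (𝓞 K)) (v : HeightOneSpectrum (𝓞 ℚ))
    (f : v.adicCompletion ℚ →+* w.adicCompletion K)
    (hv : ∃ β : absoluteGaloisGroup (v.adicCompletion ℚ) → AddCircle (1 : ℚ), IsLocallyConstant β ∧
      (∀ σ τ, z (absGaloisRestrict ℚ (v.adicCompletion ℚ) σ)
          (absGaloisRestrict ℚ (v.adicCompletion ℚ) τ) + β (σ * τ) = β σ + β τ) ∧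
      ∀ σ, p • β σ = 0) :
    ∃ β : absoluteGaloisGroup (w.adicCompletion K) → AddCircle (1 : ℚ), IsLocallyConstant β ∧
      (∀ x y, z (absGaloisRestrict ℚ K (absGaloisRestrict K (w.adicCompletion K) x))
          (absGaloisRestrict ℚ K (absGaloisRestrict K (w.adicCompletion K) y)) + β (x * y) =
        β x + β y) ∧
      ∀ x, p • β x = 0 := by
  classical
  letI algv : Algebra (v.adicCompletion ℚ) (w.adicCompletion K) := f.toAlgebra
  letI algQ : Algebra ℚ (w.adicCompletion K) :=
    ((algebraMap K (w.adicCompletion K)).comp (algebraMap ℚ K)).toAlgebra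
  -- the four restriction maps
  set i := absGaloisRestrict ℚ K with hi_def
  set rK := absGaloisRestrict K (w.adicCompletion K) with hrK_def
  set rv := absGaloisRestrict ℚ (v.adicCompletion ℚ) with hrv_def
  set j := absGaloisRestrict (v.adicCompletion ℚ) (w.adicCompletion K) with hj_def
  -- the two embeddings `ℚ̄ → \bar{K_w}`
  set e₁ : AlgebraicClosure ℚ →+* AlgebraicClosure (w.adicCompletion K) :=
    (absClosureEmbedding K (w.adicCompletion K)).toRingHom.comp
      (absClosureEmbedding ℚ K).toRingHom with he₁_def
  set e₂ : AlgebraicClosure ℚ →+* AlgebraicClosure (w.adicCompletion K) :=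
    (absClosureEmbedding (v.adicCompletion ℚ) (w.adicCompletion K)).toRingHom.comp
      (absClosureEmbedding ℚ (v.adicCompletion ℚ)).toRingHom with he₂_def
  have he₁ : ∀ a, e₁ a = absClosureEmbedding K (w.adicCompletion K) (absClosureEmbedding ℚ K a) :=
    fun a => rfl
  have he₂ : ∀ a, e₂ a = absClosureEmbedding (v.adicCompletion ℚ) (w.adicCompletion K)
      (absClosureEmbedding ℚ (v.adicCompletion ℚ) a) := fun a => rfl
  -- compatibilities with the restriction maps
  have hc₁ : ∀ (x : absoluteGaloisGroup (w.adicCompletion K)) (a : AlgebraicClosure ℚ),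
      e₁ (i (rK x) • a) = x • e₁ a := fun x a => by
    rw [he₁, he₁, hi_def, absGaloisRestrict_apply_smul, hrK_def, absGaloisRestrict_apply_smul]
  have hc₂ : ∀ (x : absoluteGaloisGroup (w.adicCompletion K)) (a : AlgebraicClosure ℚ),
      e₂ (rv (j x) • a) = x • e₂ a := fun x a => by
    rw [he₂, he₂, hrv_def, absGaloisRestrict_apply_smul, hj_def, absGaloisRestrict_apply_smul]
  -- both embeddings are `ℚ`-algebra maps, hence are `ACE ∘ τ₁`, `ACE ∘ τ₂`
  obtain ⟨τ₁, hτ₁⟩ := exists_absClosureEmbedding_comp_eq ℚ (w.adicCompletion K) e₁.toRatAlgHom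
  obtain ⟨τ₂, hτ₂⟩ := exists_absClosureEmbedding_comp_eq ℚ (w.adicCompletion K) e₂.toRatAlgHom
  obtain ⟨τ, hτ⟩ : ∃ τ : absoluteGaloisGroup ℚ, τ = τ₁⁻¹ * τ₂ := ⟨_, rfl⟩
  have he : ∀ a, e₂ a = e₁ (τ • a) := fun a => by
    have h1 : absClosureEmbedding ℚ (w.adicCompletion K) (τ₂ • a) = e₂ a := hτ₂ a
    have h2 : absClosureEmbedding ℚ (w.adicCompletion K) (τ₁ • ((τ₁⁻¹ * τ₂) • a)) =
        e₁ ((τ₁⁻¹ * τ₂) • a) := hτ₁ _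
    rw [← mul_smul, mul_inv_cancel_left] at h2
    rw [hτ, ← h2]
    exact h1.symm
  -- the two maps `Γ_{K_w} → Γ_ℚ` are conjugate by `τ`
  have hconj : ∀ x, rv (j x) = τ⁻¹ * i (rK x) * τ := fun x => by
    have key : τ * rv (j x) = i (rK x) * τ := by
      apply FaithfulSMul.eq_of_smul_eq_smul (α := AlgebraicClosure ℚ)
      intro a
      apply e₁.injective
      rw [mul_smul, mul_smul, ← he, hc₂, he, hc₁]
    exact (eq_inv_mul_of_mul_eq key).trans (mul_assoc _ _ _).symm
  -- transport the splitting
  obtain ⟨βv, hβv_lc, hβv, hβvp⟩ := hv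
  set c : absoluteGaloisGroup ℚ → AddCircle (1 : ℚ) := fun a => z τ (τ⁻¹ * a * τ) - z a τ with hc_def
  have hc_lc : IsLocallyConstant c := by
    have h1 : IsLocallyConstant fun a : absoluteGaloisGroup ℚ => z τ (τ⁻¹ * a * τ) :=
      hz_lc.comp_continuous
        (continuous_const.prodMk ((continuous_const.mul continuous_id).mul continuous_const))
    have h2 : IsLocallyConstant fun a : absoluteGaloisGroup ℚ => z a τ :=
      hz_lc.comp_continuous (continuous_id.prodMk continuous_const)
    exact h1.comp₂ h2 fun x y => x - y
  have hcp : ∀ a, p • c a = 0 := fun a => by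
    simp only [hc_def, nsmul_sub, hz_p, sub_self]
  refine ⟨fun x => βv (j x) - c (i (rK x)), ?_, fun x y => ?_, fun x => ?_⟩
  · exact (hβv_lc.comp_continuous j.continuous).comp₂
      (hc_lc.comp_continuous (i.continuous.comp rK.continuous)) fun a b => a - b
  · have h1 := hβv (j x) (j y)
    rw [← map_mul, hconj, hconj] at h1
    have h2 : z (τ⁻¹ * i (rK x) * τ) (τ⁻¹ * i (rK y) * τ) + c (i (rK x) * i (rK y)) =
        z (i (rK x)) (i (rK y)) + c (i (rK x)) + c (i (rK y)) :=
      twoCocycle_conj_eq_add_coboundary z hz_coc τ (i (rK x)) (i (rK y))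
    have g1 : z (τ⁻¹ * i (rK x) * τ) (τ⁻¹ * i (rK y) * τ) =
        βv (j x) + βv (j y) - βv (j (x * y)) := eq_sub_of_add_eq h1
    have g2 : z (i (rK x)) (i (rK y)) + (c (i (rK x)) + c (i (rK y))) =
        z (τ⁻¹ * i (rK x) * τ) (τ⁻¹ * i (rK y) * τ) + c (i (rK x) * i (rK y)) := by
      rw [← add_assoc]
      exact h2.symm
    have e2 : z (i (rK x)) (i (rK y)) =
        βv (j x) + βv (j y) - βv (j (x * y)) + c (i (rK x) * i (rK y)) - c (i (rK x)) -
          c (i (rK y)) := by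
      rw [eq_sub_of_add_eq g2, g1]
      abel
    show z (i (rK x)) (i (rK y)) + (βv (j (x * y)) - c (i (rK (x * y)))) =
      (βv (j x) - c (i (rK x))) + (βv (j y) - c (i (rK y)))
    rw [map_mul rK x y, map_mul i, e2]
    abel
  · show p • (βv (j x) - c (i (rK x))) = 0
    rw [nsmul_sub, hβvp, hcp, sub_zero]

end FiniteTransfer

/-! ### Infinite places: `p`-torsion splittings for odd `p` -/

section Infinite

variable {K : Type*} [Field K]

/-- At an infinite place `w`, `Γ_{K_w}` has order `≤ 2`; hence for an odd prime `p` every locally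
constant `p`-torsion `2`-cocycle on it is the coboundary of a locally constant **`p`-torsion**
cochain (`H²(C, ℤ/p) = 0` for `#C ∣ 2`, `p` odd; Serre §6.5 (b): "the case when `K` is Archimedean
is trivial", and §6.5 (c) (ii): `α_v = 0` if `v` is real and `p ≠ 2`). [cite: SerreDurham1977, §6.5 (b), (c) (ii)] -/
theorem localSplitting_infinite_of_odd (w : InfinitePlace K) {p : ℕ} (hp : p.Prime) (hp2 : p ≠ 2)
    (g : absoluteGaloisGroup w.Completion → absoluteGaloisGroup w.Completion → AddCircle (1 : ℚ))
    (hg : IsLocallyConstant (Function.uncurry g))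
    (hcoc : ∀ σ τ υ, g σ τ + g (σ * τ) υ = g τ υ + g σ (τ * υ)) (hpg : ∀ σ τ, p • g σ τ = 0) :
    ∃ β : absoluteGaloisGroup w.Completion → AddCircle (1 : ℚ), IsLocallyConstant β ∧
      (∀ σ τ, g σ τ + β (σ * τ) = β σ + β τ) ∧ ∀ σ, p • β σ = 0 := by
  haveI := finite_absoluteGaloisGroup_completion_infinitePlace w
  obtain ⟨c, hc_lc, hc⟩ :=
    twoCocycle_addCircle_split_absoluteGaloisGroup_completion_infinitePlace w g hg hcoc
  obtain ⟨a, β, hβ_lc, hβa, hβ⟩ := exists_primePow_torsion_coboundary_of_coboundary hp hpg hc_lc hc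
  refine ⟨β, hβ_lc, hβ, fun σ => ?_⟩
  -- `λ = p • β` is an additive character on a group of exponent `2`
  have hadd : ∀ σ τ, p • β (σ * τ) = p • β σ + p • β τ := character_nsmul_of_coboundary hpg hβ
  have hcard : Nat.card (absoluteGaloisGroup w.Completion) ∣ 2 := by
    have hle := natCard_absoluteGaloisGroup_completion_infinitePlace_le_two w
    have hpos : 0 < Nat.card (absoluteGaloisGroup w.Completion) := Nat.card_pos
    interval_cases h : Nat.card (absoluteGaloisGroup w.Completion)
    · exact one_dvd _
    · exact dvd_rfl
  have hsq : σ * σ = 1 := by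
    obtain ⟨k, hk⟩ := hcard
    have h1 : σ ^ (Nat.card (absoluteGaloisGroup w.Completion) * k) = 1 := by
      rw [pow_mul, pow_card_eq_one', one_pow]
    rwa [← hk, pow_two] at h1
  have h1' : p • β 1 = 0 := character_apply_one (ψ := fun σ => p • β σ) hadd
  have h2 : 2 • (p • β σ) = 0 := by
    rw [two_nsmul, ← hadd, hsq, h1']
  have hpa : p ^ a • (p • β σ) = 0 := by rw [smul_comm, hβa, smul_zero]
  have hcop : Nat.Coprime 2 (p ^ a) :=
    (Nat.coprime_primes Nat.prime_two hp |>.mpr (Ne.symm hp2)).pow_right a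
  have h := gcd_nsmul_eq_zero h2 hpa
  rwa [Nat.Coprime.gcd_eq_one hcop, one_nsmul] at h

end Infinite

/-! ### The Hasse input at `p` from `brauerHassePrinciple (ℚ(μ_p))` -/

section Bridge

open IsCyclotomicExtension

/-- The continuous extension `ℚ_v → K_w` of `ℚ → K` to the completions at finite places `w ∣ v`
exists (Mathlib: `UniformSpace.Completion.mapRingHom` of the uniformly continuous
`algebraMap : WithVal v → WithVal w`, `HeightOneSpectrum.uniformContinuous_algebraMap_liesOver`;
cf. `EllipticCurves/ShaRestriction.adicCompletionMap`). [folklore] -/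
theorem exists_ringHom_adicCompletion_rat (K : Type) [Field K] [NumberField K]
    (w : HeightOneSpectrum (𝓞 K)) :
    ∃ (v : HeightOneSpectrum (𝓞 ℚ)), Nonempty (v.adicCompletion ℚ →+* w.adicCompletion K) := by
  let v : HeightOneSpectrum (𝓞 ℚ) := w.under (𝓞 ℚ)
  haveI : w.asIdeal.LiesOver v.asIdeal := ⟨rfl⟩
  exact ⟨v, ⟨(HeightOneSpectrum.adicCompletion.equiv K w).symm.toRingHom.comp
    ((UniformSpace.Completion.mapRingHom
        (algebraMap (WithVal (v.valuation ℚ)) (WithVal (w.valuation K)))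
        (HeightOneSpectrum.uniformContinuous_algebraMap_liesOver ℚ K v w).continuous).comp
      (HeightOneSpectrum.adicCompletion.equiv ℚ v).toRingHom)⟩⟩

/-- At a complex place `w`, `K_w ≅ ℂ` is algebraically closed and `Γ_{K_w}` is trivial. [folklore] -/
theorem subsingleton_absoluteGaloisGroup_completion_of_isComplex {K : Type*} [Field K]
    (w : InfinitePlace K) (hw : w.IsComplex) : Subsingleton (absoluteGaloisGroup w.Completion) := by
  let e : w.Completion ≃+* ℂ := InfinitePlace.Completion.ringEquivComplexOfIsComplex hw
  letI : Algebra w.Completion ℂ := e.toRingHom.toAlgebra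
  have hrank : Module.finrank w.Completion ℂ = 1 := by
    rw [Algebra.finrank_eq_of_equiv_equiv e (RingEquiv.refl ℂ) (by ext; rfl), Module.finrank_self]
  haveI : FiniteDimensional w.Completion ℂ :=
    Module.finite_of_finrank_pos (by rw [hrank]; exact one_pos)
  haveI : IsAlgClosure w.Completion ℂ := ⟨Complex.isAlgClosed, Algebra.IsAlgebraic.of_finite _ _⟩
  let φ : AlgebraicClosure w.Completion ≃ₐ[w.Completion] ℂ := IsAlgClosure.equiv w.Completion _ ℂ
  have hinj : Function.Injective fun σ : absoluteGaloisGroup w.Completion => AlgEquiv.autCongr φ σ :=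
    (AlgEquiv.autCongr φ).injective
  have hcard : Fintype.card (ℂ ≃ₐ[w.Completion] ℂ) ≤ 1 := AlgEquiv.card_le.trans hrank.le
  haveI : Subsingleton (ℂ ≃ₐ[w.Completion] ℂ) := Fintype.card_le_one_iff_subsingleton.mp hcard
  exact hinj.subsingleton

/-- **The Hasse input at `p` from the Hasse principle for `Br K`** (Serre, Durham §6.5 (a), (c):
`H²(G_K, ℤ/p) = H²(G_K, μ_p) = Br_p(K)` when `μ_p ⊂ K`, and "an element `α ∈ Br_p(K)` is described
by its local components").  Let `K` be a number field containing a primitive `p`-th root of unity,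
with `p` odd or `K` totally complex, and assume `brauerHassePrinciple K`.  Then every locally
constant `p`-torsion `2`-cocycle `z : Γ_ℚ × Γ_ℚ → ℚ/ℤ` which is, at every finite place `v` of `ℚ`,
the coboundary on `Γ_{ℚ_v}` of a locally constant `p`-torsion cochain, pulls back along
`Γ_K → Γ_ℚ` to the coboundary of a locally constant `p`-torsion cochain.
Proof: `e = ζ^{p z}` on `Γ_K` is a locally constant `K̄ˣ`-valued `2`-cocycle (the Galois action is
trivial on `μ_p ⊂ K`); it is locally a coboundary at the finite places
(`rat_localSplitting_transfer_finite`) and at the infinite places (`localSplitting_infinite_of_odd`,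
resp. `Γ_{K_w} = 1` at complex places); by the fact `e = ∂b`; `σ ↦ b(σ)^p` is a `1`-cocycle,
`= σ(a)/a` by Hilbert 90, and `b' = b · α/σ(α)` (`α^p = a`) is `μ_p`-valued with `∂b' = e`;
reading exponents gives `z|_{Γ_K} = ∂β`.
[cite: SerreDurham1977, §6.5 (a), (c)] [cite: Harari2020, Thm. 14.11] -/
theorem hasseInput_of_brauerHassePrinciple (K : Type) [Field K] [NumberField K] {p : ℕ}
    (hp : p.Prime) {ζ : K} (hζ : IsPrimitiveRoot ζ p)
    (hKinf : p ≠ 2 ∨ ∀ w : InfinitePlace K, w.IsComplex) (hB : brauerHassePrinciple K)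
    (z : absoluteGaloisGroup ℚ → absoluteGaloisGroup ℚ → AddCircle (1 : ℚ))
    (hz_lc : IsLocallyConstant (Function.uncurry z))
    (hz_coc : ∀ σ τ υ, z σ τ + z (σ * τ) υ = z τ υ + z σ (τ * υ)) (hz_p : ∀ σ τ, p • z σ τ = 0)
    (hz_loc : ∀ v : HeightOneSpectrum (𝓞 ℚ),
      ∃ β : absoluteGaloisGroup (v.adicCompletion ℚ) → AddCircle (1 : ℚ), IsLocallyConstant β ∧
        (∀ σ τ, z (absGaloisRestrict ℚ (v.adicCompletion ℚ) σ)
            (absGaloisRestrict ℚ (v.adicCompletion ℚ) τ) + β (σ * τ) = β σ + β τ) ∧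
        ∀ σ, p • β σ = 0) :
    ∃ b : absoluteGaloisGroup K → AddCircle (1 : ℚ), IsLocallyConstant b ∧ (∀ σ, p • b σ = 0) ∧
      ∀ σ τ, z (absGaloisRestrict ℚ K σ) (absGaloisRestrict ℚ K τ) + b (σ * τ) = b σ + b τ := by
  classical
  haveI : Fact p.Prime := ⟨hp⟩
  haveI : NeZero p := ⟨hp.ne_zero⟩
  set i := absGaloisRestrict ℚ K with hi_def
  -- `ζ ∈ K̄`, a primitive `p`-th root of unity fixed by `Γ_K`
  set ζb : AlgebraicClosure K := algebraMap K _ ζ with hζb_def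
  have hζb : IsPrimitiveRoot ζb p := hζ.map_of_injective (algebraMap K _).injective
  have hζb0 : ζb ≠ 0 := hζb.ne_zero hp.ne_zero
  have hζb_fix : ∀ σ : absoluteGaloisGroup K, σ • ζb = ζb := fun σ => by
    rw [absoluteGaloisGroup.smul_def, hζb_def, AlgEquiv.commutes]
  obtain ⟨m, hm_add, hm_inj, hm0, hm_pow, hm_range, hm_surj⟩ := exists_mulExp_of_isPrimitiveRoot hp.pos hζb
  have hm0' : ∀ x, m x ≠ 0 := fun x => by
    obtain ⟨k, hk⟩ := hm_range x
    rw [hk]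
    exact pow_ne_zero _ hζb0
  have hm_fix : ∀ (ρ : absoluteGaloisGroup K) x, ρ • m x = m x := fun ρ x => by
    obtain ⟨k, hk⟩ := hm_range x
    rw [hk, smul_pow', hζb_fix]
  have hm_sub : ∀ x y, p • x = 0 → p • y = 0 → m (x - y) * m y = m x := fun x y hx hy => by
    rw [← hm_add _ _ (by rw [nsmul_sub, hx, hy, sub_zero]) hy, sub_add_cancel]
  -- the cocycle `E = m ∘ z ∘ (i × i)` on `Γ_K`
  set E : absoluteGaloisGroup K → absoluteGaloisGroup K →
      AlgebraicClosure K := fun σ τ => m (z (i σ) (i τ)) with hE_def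
  have hE0 : ∀ σ τ, E σ τ ≠ 0 := fun σ τ => hm0' _
  have hE_lc : IsLocallyConstant
      (fun q : absoluteGaloisGroup K × absoluteGaloisGroup K =>
        E q.1 q.2) :=
    (hz_lc.comp_continuous (i.continuous.prodMap i.continuous)).comp m
  have hE_coc : ∀ σ τ υ, E σ τ * E (σ * τ) υ = σ • E τ υ * E σ (τ * υ) := fun σ τ υ => by
    rw [hm_fix]
    simp only [hE_def, map_mul]
    rw [← hm_add _ _ (hz_p _ _) (hz_p _ _), ← hm_add _ _ (hz_p _ _) (hz_p _ _), hz_coc]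
  -- local conditions at the finite places of `K`
  have hfin : ∀ w : HeightOneSpectrum (𝓞 K),
      ∃ b : absoluteGaloisGroup (w.adicCompletion K) →
          AlgebraicClosure (w.adicCompletion K),
        IsLocallyConstant b ∧ (∀ x, b x ≠ 0) ∧
          ∀ x y, absClosureEmbedding K (w.adicCompletion K)
              (E (absGaloisRestrict K (w.adicCompletion K) x)
                (absGaloisRestrict K (w.adicCompletion K) y)) =
            b x * x • b y / b (x * y) := by
    intro w
    obtain ⟨v, ⟨f⟩⟩ := exists_ringHom_adicCompletion_rat K w
    obtain ⟨β, hβ_lc, hβ, hβp⟩ := rat_localSplitting_transfer_finite K z hz_lc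
      hz_coc hz_p w v f (hz_loc v)
    set ι := absClosureEmbedding K (w.adicCompletion K) with hι
    set r := absGaloisRestrict K (w.adicCompletion K) with hr
    have hι_fix : ∀ (x : absoluteGaloisGroup (w.adicCompletion K)) t,
        x • ι (m t) = ι (m t) := fun x t => by
      obtain ⟨k, hk⟩ := hm_range t
      rw [hk, map_pow, smul_pow', hι, hζb_def, AlgHom.commutes,
        IsScalarTower.algebraMap_apply K (w.adicCompletion K)
          (AlgebraicClosure (w.adicCompletion K)), absoluteGaloisGroup.smul_def,
        AlgEquiv.commutes]
    refine ⟨fun x => ι (m (β x)), hβ_lc.comp fun t => ι (m t), fun x => ?_, fun x y => ?_⟩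
    · exact (map_ne_zero ι).mpr (hm0' _)
    · rw [hι_fix]
      show ι (m (z (i (r x)) (i (r y)))) = ι (m (β x)) * ι (m (β y)) / ι (m (β (x * y)))
      have hzr : z (i (r x)) (i (r y)) = β x + β y - β (x * y) := eq_sub_of_add_eq (hβ x y)
      rw [hzr, eq_div_iff ((map_ne_zero ι).mpr (hm0' _)), ← map_mul, ← map_mul,
        hm_sub _ _ (by rw [nsmul_add, hβp, hβp, add_zero]) (hβp _), hm_add _ _ (hβp _) (hβp _)]
  -- local conditions at the infinite places of `K`
  have hinf : ∀ w : InfinitePlace K,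
      ∃ b : absoluteGaloisGroup w.Completion → AlgebraicClosure w.Completion,
        IsLocallyConstant b ∧ (∀ x, b x ≠ 0) ∧
          ∀ x y, absClosureEmbedding K w.Completion
              (E (absGaloisRestrict K w.Completion x) (absGaloisRestrict K w.Completion y)) =
            b x * x • b y / b (x * y) := by
    intro w
    set ι := absClosureEmbedding K w.Completion with hι
    set r := absGaloisRestrict K w.Completion with hr
    have hι_fix : ∀ (x : absoluteGaloisGroup w.Completion) t, x • ι (m t) = ι (m t) := fun x t => by
      obtain ⟨k, hk⟩ := hm_range t
      rw [hk, map_pow, smul_pow', hι, hζb_def, AlgHom.commutes,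
        IsScalarTower.algebraMap_apply K w.Completion
          (AlgebraicClosure w.Completion), absoluteGaloisGroup.smul_def, AlgEquiv.commutes]
    -- a `p`-torsion splitting of `z ∘ (i r × i r)` on `Γ_{K_w}`
    obtain ⟨β, hβ_lc, hβ, hβp⟩ : ∃ β : absoluteGaloisGroup w.Completion → AddCircle (1 : ℚ),
        IsLocallyConstant β ∧ (∀ x y, z (i (r x)) (i (r y)) + β (x * y) = β x + β y) ∧
        ∀ x, p • β x = 0 := by
      rcases hKinf with hp2 | hcx
      · exact localSplitting_infinite_of_odd w hp hp2 (fun x y => z (i (r x)) (i (r y)))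
          (hz_lc.comp_continuous
            ((i.continuous.comp r.continuous).prodMap (i.continuous.comp r.continuous)))
          (fun x y u => by simpa only [map_mul] using hz_coc (i (r x)) (i (r y)) (i (r u)))
          (fun x y => hz_p _ _)
      · haveI := subsingleton_absoluteGaloisGroup_completion_of_isComplex w (hcx w)
        refine ⟨fun _ => z 1 1, IsLocallyConstant.const _, fun x y => ?_, fun x => hz_p _ _⟩
        rw [Subsingleton.elim x 1, Subsingleton.elim y 1, mul_one, map_one, map_one]
    refine ⟨fun x => ι (m (β x)), hβ_lc.comp fun t => ι (m t), fun x => ?_, fun x y => ?_⟩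
    · exact (map_ne_zero ι).mpr (hm0' _)
    · rw [hι_fix]
      show ι (m (z (i (r x)) (i (r y)))) = ι (m (β x)) * ι (m (β y)) / ι (m (β (x * y)))
      have hzr : z (i (r x)) (i (r y)) = β x + β y - β (x * y) := eq_sub_of_add_eq (hβ x y)
      rw [hzr, eq_div_iff ((map_ne_zero ι).mpr (hm0' _)), ← map_mul, ← map_mul,
        hm_sub _ _ (by rw [nsmul_add, hβp, hβp, add_zero]) (hβp _), hm_add _ _ (hβp _) (hβp _)]
  -- the Hasse principle: `E = ∂b`
  obtain ⟨b, hb_lc, hb0, hb⟩ := hB E hE_lc hE0 hE_coc hfin hinf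
  -- Hilbert 90 for `σ ↦ b(σ)^p`
  have hbE : ∀ σ τ, b (σ * τ) * E σ τ = b σ * σ • b τ := fun σ τ => by
    rw [hb σ τ, mul_div_cancel₀ _ (hb0 _)]
  have hcoc1 : ∀ σ τ, (fun σ => b σ ^ p) (σ * τ) = (fun σ => b σ ^ p) σ * σ • (fun σ => b σ ^ p) τ :=
    fun σ τ => by
      have h := congrArg (fun x => x ^ p) (hbE σ τ)
      simp only [mul_pow] at h
      rw [show E σ τ ^ p = 1 from hm_pow _, mul_one] at h
      show b (σ * τ) ^ p = b σ ^ p * σ • (b τ ^ p)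
      rw [h, smul_pow']
  obtain ⟨a, ha0, ha⟩ := absoluteGaloisGroup.exists_eq_smul_div_of_isLocallyConstant_cocycle
    K (hb_lc.comp fun x => x ^ p) (fun σ => pow_ne_zero _ (hb0 σ)) hcoc1
  -- a `p`-th root `α` of `a`, and the `μ_p`-valued cochain `b' = b α / σ(α)`
  obtain ⟨α, hα⟩ := IsAlgClosed.exists_pow_nat_eq a hp.pos
  have hα0 : α ≠ 0 := fun h => ha0 (by rw [← hα, h, zero_pow hp.ne_zero])
  have hσα0 : ∀ σ : absoluteGaloisGroup K, σ • α ≠ 0 := fun σ => by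
    rw [absoluteGaloisGroup.smul_def]
    exact (map_ne_zero _).mpr hα0
  have hσa0 : ∀ σ : absoluteGaloisGroup K, σ • a ≠ 0 := fun σ => by
    rw [absoluteGaloisGroup.smul_def]
    exact (map_ne_zero _).mpr ha0
  set b' : absoluteGaloisGroup K → AlgebraicClosure K :=
    fun σ => b σ * α / σ • α with hb'_def
  have hb'0 : ∀ σ, b' σ ≠ 0 := fun σ =>
    div_ne_zero (mul_ne_zero (hb0 σ) hα0) (hσα0 σ)
  have hb'_pow : ∀ σ, b' σ ^ p = 1 := fun σ => by
    have h : b σ ^ p = σ • a / a := ha σ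
    have h1 := hσa0 σ
    show (b σ * α / σ • α) ^ p = 1
    rw [div_pow, mul_pow, h, ← smul_pow', hα]
    field_simp
  have hb'_lc : IsLocallyConstant b' := by
    have h1 : IsLocallyConstant fun σ : absoluteGaloisGroup K => σ • α := by
      have h := (isLocallyConstant_smul_units K (Units.mk0 α hα0)).comp
        fun u : (AlgebraicClosure K)ˣ => (u : AlgebraicClosure K)
      have heq : ((fun u : (AlgebraicClosure K)ˣ =>
            (u : AlgebraicClosure K)) ∘
          fun σ : absoluteGaloisGroup K => σ • Units.mk0 α hα0) =
          fun σ => σ • α := by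
        funext σ
        rfl
      rw [heq] at h
      exact h
    exact (hb_lc.comp fun x => x * α).comp₂ h1 fun x y => x / y
  -- `b'` is `μ_p`-valued: exponents
  have hF : ∀ y : AlgebraicClosure K, ∃ x : AddCircle (1 : ℚ), p • x = 0 ∧
      (y ^ p = 1 → m x = y) := fun y => by
    by_cases hy : y ^ p = 1
    · obtain ⟨k, -, hk⟩ := hζb.eq_pow_of_pow_eq_one hy
      obtain ⟨x, hxp, hx⟩ := hm_surj k
      exact ⟨x, hxp, fun _ => by rw [hx, hk]⟩
    · exact ⟨0, smul_zero _, fun h => absurd h hy⟩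
  choose F hFp hF using hF
  set B : absoluteGaloisGroup K → AddCircle (1 : ℚ) := fun σ => F (b' σ)
    with hB_def
  have hBp : ∀ σ, p • B σ = 0 := fun σ => hFp _
  have hBm : ∀ σ, m (B σ) = b' σ := fun σ => hF _ (hb'_pow σ)
  have hB_lc : IsLocallyConstant B := hb'_lc.comp F
  -- `∂b' = E`: the correction terms cancel, and `b'` is fixed by `Γ_K`
  have hb'_fix : ∀ ρ σ, ρ • b' σ = b' σ := fun ρ σ => by rw [← hBm, hm_fix]
  have hEb' : ∀ σ τ, E σ τ * b' (σ * τ) = b' σ * b' τ := fun σ τ => by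
    have h1 : b' τ = σ • b' τ := (hb'_fix σ τ).symm
    have h2 := hσα0 σ
    have h3 := hσα0 τ
    have h4 := hσα0 (σ * τ)
    have h5 := hb0 σ
    have h6 := hb0 τ
    have h7 := hb0 (σ * τ)
    have hσb0 : σ • b τ ≠ 0 := by
      rw [absoluteGaloisGroup.smul_def]
      exact (map_ne_zero _).mpr (hb0 τ)
    rw [h1, hb σ τ]
    simp only [hb'_def]
    rw [absoluteGaloisGroup.smul_def σ (b τ * α / τ • α), map_div₀, map_mul,
      ← absoluteGaloisGroup.smul_def, ← absoluteGaloisGroup.smul_def,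
      ← absoluteGaloisGroup.smul_def, ← mul_smul]
    field_simp
  -- conclusion: `z|_{Γ_K} = ∂B`
  refine ⟨B, hB_lc, hBp, fun σ τ => ?_⟩
  have key : m (z (i σ) (i τ)) = m (B σ + B τ - B (σ * τ)) := by
    have h := hEb' σ τ
    rw [← hBm, ← hBm, ← hBm, ← hm_add _ _ (hBp σ) (hBp τ),
      ← hm_sub (B σ + B τ) (B (σ * τ)) (by rw [nsmul_add, hBp, hBp, add_zero]) (hBp _)] at h
    exact mul_right_cancel₀ (hm0' _) h
  have h := hm_inj _ _ (hz_p _ _)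
    (by rw [nsmul_sub, nsmul_add, hBp, hBp, hBp, add_zero, sub_zero]) key
  rw [h]
  abel

/-- **`H²(G_ℚ, ℚ_p/ℤ_p) = 0` (cochain form) for odd `p`, from the Hasse principle for
`Br(ℚ(μ_p))`** (Serre, Durham §6.5): every locally constant `p`-torsion `2`-cocycle on `Γ_ℚ` with
values in `ℚ/ℤ` is the coboundary of a locally constant cochain, granted
`brauerHassePrinciple (CyclotomicField p ℚ)`.
[cite: SerreDurham1977, §6.5] [cite: Harari2020, Thm. 14.11] -/
theorem twoCocycle_addCircle_prime_split_rat_of_brauerHassePrinciple {p : ℕ} (hp : p.Prime)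
    (hp2 : p ≠ 2) (hB : brauerHassePrinciple (CyclotomicField p ℚ))
    (g : absoluteGaloisGroup ℚ → absoluteGaloisGroup ℚ → AddCircle (1 : ℚ))
    (hg : IsLocallyConstant (Function.uncurry g))
    (hcoc : ∀ σ τ υ, g σ τ + g (σ * τ) υ = g τ υ + g σ (τ * υ)) (hpg : ∀ σ τ, p • g σ τ = 0) :
    ∃ b : absoluteGaloisGroup ℚ → AddCircle (1 : ℚ), IsLocallyConstant b ∧
      ∀ σ τ, g σ τ + b (σ * τ) = b σ + b τ :=
  haveI : NeZero p := ⟨hp.ne_zero⟩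
  haveI : IsCyclotomicExtension {p} ℚ (CyclotomicField p ℚ) :=
    CyclotomicField.isCyclotomicExtension p ℚ
  haveI : NumberField (CyclotomicField p ℚ) :=
    IsCyclotomicExtension.numberField {p} ℚ (CyclotomicField p ℚ)
  twoCocycle_addCircle_prime_split_rat_of_hasseInput_odd hp hp2
    (fun z hz_lc hz_coc hz_p hz_loc => by
      obtain ⟨b, hb, -, hb'⟩ := hasseInput_of_brauerHassePrinciple (CyclotomicField p ℚ) hp
        (zeta_spec p ℚ (CyclotomicField p ℚ)) (Or.inl hp2) hB z hz_lc hz_coc hz_p hz_loc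
      exact ⟨b, hb, hb'⟩) g hg hcoc hpg

/-- **`Tate_projectiveLifting` from the Hasse principle for `Br(ℚ(μ_p))` (all odd `p`) and
`(H_2)(Γ_ℚ)`.**  The named fact `Tate_projectiveLifting` (Serre, Durham 1977, §6.1 Cor. to Thm. 4:
every projective representation of `G_ℚ` with open kernel over an algebraically closed field lifts)
follows from the named fact `brauerHassePrinciple (CyclotomicField p ℚ)` for every odd prime `p`
(Brauer–Hasse–Noether, Harari Thm. 14.11 — Serre's global input in §6.5 (c)) together with the
cochain statement `(H_2)(Γ_ℚ)` at the prime `2` (treated in the sequel through `ℚ(i)`).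
[cite: SerreDurham1977, §6.1 Cor. to Thm. 4, §6.5] [cite: Harari2020, Thm. 14.11] -/
theorem Tate_projectiveLifting_of_brauerHassePrinciple
    (hB : ∀ p : ℕ, p.Prime → p ≠ 2 → brauerHassePrinciple (CyclotomicField p ℚ))
    (H2 : ∀ g : absoluteGaloisGroup ℚ → absoluteGaloisGroup ℚ → AddCircle (1 : ℚ),
      IsLocallyConstant (Function.uncurry g) →
      (∀ σ τ υ, g σ τ + g (σ * τ) υ = g τ υ + g σ (τ * υ)) → (∀ σ τ, 2 • g σ τ = 0) →
      ∃ c : absoluteGaloisGroup ℚ → AddCircle (1 : ℚ), IsLocallyConstant c ∧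
        ∀ σ τ, g σ τ + c (σ * τ) = c σ + c τ) :
    Tate_projectiveLifting :=
  Tate_projectiveLifting_of_hasseInput
    (fun p hp hp2 z hz_lc hz_coc hz_p hz_loc => by
      haveI : NeZero p := ⟨hp.ne_zero⟩
      haveI : IsCyclotomicExtension {p} ℚ (CyclotomicField p ℚ) :=
        CyclotomicField.isCyclotomicExtension p ℚ
      haveI : NumberField (CyclotomicField p ℚ) :=
        IsCyclotomicExtension.numberField {p} ℚ (CyclotomicField p ℚ)
      obtain ⟨b, hb, -, hb'⟩ := hasseInput_of_brauerHassePrinciple (CyclotomicField p ℚ) hp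
        (zeta_spec p ℚ (CyclotomicField p ℚ)) (Or.inl hp2) (hB p hp hp2) z hz_lc hz_coc hz_p hz_loc
      exact ⟨b, hb, hb'⟩) H2

end Bridge

end Literature.NumberTheory.GaloisRepresentations

end
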